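import Mathlib

/-!
# The tail bound behind a «dominant term» argument (support, seat p1)

A family of complex weights `w N x = a x * b N x` indexed by «orbits» `x : Orb` (any type) and a level
`N : ℕ`, with a distinguished orbit `x0`. The orbits are graded by a size `size : Orb → ℝ` and the
bracket `k = ⌊size x⌋₊`. At level `N` only the orbits with `arith N x` carry a non-zero `b N x`.

* `tail_le_shifted_tsum` (one level `N`, the non-asymptotic inequality): if on the orbits carrying weight
  `‖a x‖ ‖b N x‖ ≤ m(k) ‖b N x0‖` (a majorant `m : ℕ → ℝ` of the bracket), the orbits carrying weight with
  bracket `k` lie in a finite set of cardinality `≤ cnt k`, the orbits `≠ x0` carrying weight have bracket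
  `≥ K`, and `∑_k cnt k · m k < ∞`, then
  `∑' x, ‖if x = x0 then 0 else w N x‖ ≤ ‖b N x0‖ · ∑' j, cnt (j + K) · m (j + K)`.
  No summability of the weights is assumed (the tail is bounded finset by finset, `Real.tsum_le_of_sum_le`).
* `tail_le_half_of_tendsto` / `tail_le_half` (the asymptotic form, in the shapes of a Gaussian–polynomial
  configuration): `‖a x‖ ≤ C (1 + size x)^d exp(−c · size x)` with `c > 0`; `‖b N x‖ ≤ B (1 + size x)^{d'} ‖b N x0‖`
  on the orbits carrying weight; the orbits carrying weight at level `N` of size `≤ R` lie in a finite set of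
  cardinality `≤ C' (1 + R)^{d''}` uniformly in `N`; an orbit `≠ x0` carrying weight at level `N` has size
  `≥ ρ N` with `ρ N → ∞` (resp. `≥ c₂ N − size x0`, `c₂ > 0`); `a x0 ≠ 0`. Then for `N` large the orbits other
  than `x0` contribute at most half of the `x0`-term: `∑' x, ‖if x = x0 then 0 else w N x‖ ≤ ½ ‖w N x0‖`.
  The signs of `C, C', B` and of the exponents `d, d', d''` are arbitrary.

Pure real analysis over an abstract index type; nothing here is about any geometric or automorphic object.
Blind lane: Mathlib only; no sorry; axioms ⊆ {propext, Classical.choice, Quot.sound}.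
-/

namespace Summit.Ventures.HodgeRepro2.T7SupportDominantTermTail

open Filter Topology

/-- **Polynomial × exponential is summable**: `∑_k (2 + k)^E exp(−c k) < ∞` for every real `E` and `c > 0`
(bounded by a geometric series after absorbing the power into `exp(−c k / 2)`). -/
theorem summable_polyExp (E c : ℝ) (hc : 0 < c) :
    Summable fun k : ℕ => (2 + (k : ℝ)) ^ E * Real.exp (-c * k) := by
  have ht := tendsto_rpow_mul_exp_neg_mul_atTop_nhds_zero E (c / 2) (by positivity)
  have h2 : Tendsto (fun k : ℕ => 2 + (k : ℝ)) atTop atTop :=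
    tendsto_atTop_add_const_left _ _ tendsto_natCast_atTop_atTop
  have hseq : Tendsto (fun k : ℕ => (2 + (k : ℝ)) ^ E * Real.exp (-(c / 2) * (2 + (k : ℝ))))
      atTop (𝓝 0) := ht.comp h2
  obtain ⟨A, hA⟩ := hseq.bddAbove_range
  have hbound : ∀ k : ℕ, (2 + (k : ℝ)) ^ E * Real.exp (-c * k) ≤
      (A * Real.exp c) * Real.exp (-(c / 2)) ^ k := by
    intro k
    have hu : (2 + (k : ℝ)) ^ E * Real.exp (-(c / 2) * (2 + (k : ℝ))) ≤ A := hA ⟨k, rfl⟩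
    have hexp : Real.exp (-c * k) =
        Real.exp (-(c / 2) * (2 + (k : ℝ))) * (Real.exp c * Real.exp (-(c / 2)) ^ k) := by
      rw [← Real.exp_nat_mul, ← Real.exp_add, ← Real.exp_add]
      congr 1
      ring
    rw [hexp]
    have hpos : 0 ≤ Real.exp c * Real.exp (-(c / 2)) ^ k := by positivity
    calc (2 + (k : ℝ)) ^ E * (Real.exp (-(c / 2) * (2 + (k : ℝ))) * (Real.exp c * Real.exp (-(c / 2)) ^ k))
        = ((2 + (k : ℝ)) ^ E * Real.exp (-(c / 2) * (2 + (k : ℝ)))) *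
            (Real.exp c * Real.exp (-(c / 2)) ^ k) := by ring
      _ ≤ A * (Real.exp c * Real.exp (-(c / 2)) ^ k) := by gcongr
      _ = (A * Real.exp c) * Real.exp (-(c / 2)) ^ k := by ring
  refine Summable.of_nonneg_of_le (fun k => by positivity) hbound ?_
  refine (summable_geometric_of_lt_one (Real.exp_pos _).le ?_).mul_left _
  rw [← Real.exp_zero]
  exact Real.exp_lt_exp.2 (by linarith)

/-- A finite sum of a non-negative summable sequence over indices `≥ K` is at most the tail sum from `K`. -/
theorem sum_le_tsum_shift (f : ℕ → ℝ) (hf : Summable f) (hf0 : ∀ n, 0 ≤ f n) (K : ℕ)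
    (t : Finset ℕ) (ht : ∀ j ∈ t, K ≤ j) : ∑ j ∈ t, f j ≤ ∑' i, f (i + K) := by
  have hinj : Set.InjOn (fun j => j - K) (t : Set ℕ) := by
    intro x hx y hy hxy
    have hx' := ht x hx
    have hy' := ht y hy
    simp only at hxy
    omega
  have h1 : ∑ j ∈ t, f j = ∑ i ∈ t.image (fun j => j - K), f (i + K) := by
    rw [Finset.sum_image hinj]
    refine Finset.sum_congr rfl fun j hj => ?_
    rw [Nat.sub_add_cancel (ht j hj)]
  rw [h1]
  exact ((summable_nat_add_iff K).2 hf).sum_le_tsum _ (fun i _ => hf0 _)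

/-- A real power with base `≥ 1` is monotone in the exponent: `y^d ≤ y^{max d 0}`. -/
theorem rpow_le_rpow_max (y d : ℝ) (hy : 1 ≤ y) : y ^ d ≤ y ^ (max d 0) :=
  Real.rpow_le_rpow_of_exponent_le hy (le_max_left d 0)

section Main

variable {Orb : Type} [DecidableEq Orb]

/-- **The tail bound at one level, non-asymptotic.** With a majorant `m` of the bracket `⌊size x⌋₊`, a bound
`cnt k` on the number of orbits carrying weight with bracket `k`, and bracket `≥ K` on the orbits `≠ x0`
carrying weight, the tail is at most `‖b N x0‖` times the shifted sum `∑' j, cnt (j + K) * m (j + K)`. -/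
theorem tail_le_shifted_tsum (N : ℕ) (x0 : Orb) (size : Orb → ℝ) (arith : ℕ → Orb → Prop)
    (a : Orb → ℂ) (b : ℕ → Orb → ℂ) (w : ℕ → Orb → ℂ) (hw : ∀ N x, w N x = a x * b N x)
    (b_support : ∀ x, b N x ≠ 0 → arith N x)
    (m cnt : ℕ → ℝ) (hm0 : ∀ k, 0 ≤ m k) (hcnt0 : ∀ k, 0 ≤ cnt k)
    (hmaj : ∀ x, arith N x → ‖a x‖ * ‖b N x‖ ≤ m ⌊size x⌋₊ * ‖b N x0‖)
    (hcnt : ∀ k : ℕ, ∃ t : Finset Orb, (∀ x, arith N x → ⌊size x⌋₊ = k → x ∈ t) ∧ (t.card : ℝ) ≤ cnt k)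
    (K : ℕ) (hK : ∀ x, arith N x → x ≠ x0 → K ≤ ⌊size x⌋₊)
    (hsum : Summable fun k => cnt k * m k) :
    (∑' x, ‖(if x = x0 then 0 else w N x)‖) ≤ ‖b N x0‖ * ∑' j, cnt (j + K) * m (j + K) := by
  classical
  set M : ℝ := ‖b N x0‖ with hM
  have hM0 : 0 ≤ M := norm_nonneg _
  have hcm0 : ∀ k, 0 ≤ cnt k * m k := fun k => mul_nonneg (hcnt0 k) (hm0 k)
  -- the fibre count on a finite set of orbits carrying weight
  have hfib : ∀ (s : Finset Orb) (j : ℕ), (∀ x ∈ s, arith N x) →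
      (((s.filter fun x => ⌊size x⌋₊ = j).card : ℝ)) ≤ cnt j := by
    intro s j hs
    obtain ⟨t, htmem, htcard⟩ := hcnt j
    have hsub : (s.filter fun x => ⌊size x⌋₊ = j) ⊆ t := by
      intro x hx
      rw [Finset.mem_filter] at hx
      exact htmem x (hs x hx.1) hx.2
    calc (((s.filter fun x => ⌊size x⌋₊ = j).card : ℝ)) ≤ (t.card : ℝ) := by
          exact_mod_cast Finset.card_le_card hsub
      _ ≤ cnt j := htcard
  -- the bound on every finite partial sum
  have hfin : ∀ s : Finset Orb,
      ∑ x ∈ s, ‖(if x = x0 then 0 else w N x)‖ ≤ M * ∑' j, cnt (j + K) * m (j + K) := by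
    intro s
    set p : Orb → Prop := fun x => x ≠ x0 ∧ arith N x with hp
    set s' : Finset Orb := s.filter p with hs'
    have hs'arith : ∀ x ∈ s', arith N x := fun x hx => (Finset.mem_filter.1 hx).2.2
    -- only the orbits of `s'` contribute
    have hF : ∀ x, ‖(if x = x0 then 0 else w N x)‖ = if p x then ‖w N x‖ else 0 := by
      intro x
      by_cases hx0 : x = x0
      · simp [hx0, hp]
      · by_cases hxa : arith N x
        · simp [hx0, hxa, hp]
        · have hb0 : b N x = 0 := by
            by_contra h
            exact hxa (b_support x h)
          simp [hx0, hxa, hp, hw, hb0]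
    have h1 : ∑ x ∈ s, ‖(if x = x0 then 0 else w N x)‖ = ∑ x ∈ s', ‖w N x‖ := by
      rw [Finset.sum_congr rfl (fun x _ => hF x), ← Finset.sum_filter]
    -- every orbit of `s'` has bracket ≥ K
    have hKs' : ∀ x ∈ s', K ≤ ⌊size x⌋₊ := by
      intro x hx
      rw [Finset.mem_filter] at hx
      exact hK x hx.2.2 hx.2.1
    calc ∑ x ∈ s, ‖(if x = x0 then 0 else w N x)‖ = ∑ x ∈ s', ‖w N x‖ := h1
      _ ≤ ∑ x ∈ s', M * m ⌊size x⌋₊ := by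
          refine Finset.sum_le_sum fun x hx => ?_
          rw [hw, norm_mul, mul_comm M]
          exact hmaj x (hs'arith x hx)
      _ = M * ∑ x ∈ s', m ⌊size x⌋₊ := by rw [Finset.mul_sum]
      _ = M * ∑ j ∈ s'.image (fun x => ⌊size x⌋₊),
            ((s'.filter fun x => ⌊size x⌋₊ = j).card : ℝ) * m j := by
          rw [Finset.sum_comp m (fun x => ⌊size x⌋₊)]
          congr 1
          refine Finset.sum_congr rfl fun j _ => ?_
          rw [nsmul_eq_mul]
      _ ≤ M * ∑ j ∈ s'.image (fun x => ⌊size x⌋₊), cnt j * m j := by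
          gcongr with j hj
          · exact hm0 j
          · exact hfib s' j hs'arith
      _ ≤ M * ∑' i, cnt (i + K) * m (i + K) := by
          gcongr
          refine sum_le_tsum_shift (fun k => cnt k * m k) hsum hcm0 K _ ?_
          intro j hj
          obtain ⟨x, hx, rfl⟩ := Finset.mem_image.1 hj
          exact hKs' x hx
  exact Real.tsum_le_of_sum_le (fun x => norm_nonneg _) hfin

/-- **The tail bound, general threshold.** In the Gaussian–polynomial shapes of the module docstring — with
the size threshold on the orbits `≠ x0` carrying weight at level `N` given by ANY sequence `ρ N → ∞` — for `N`
large the orbits other than `x0` contribute at most half of the `x0`-term. -/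
theorem tail_le_half_of_tendsto
    (x0 : Orb) (size : Orb → ℝ) (arith : ℕ → Orb → Prop) (a : Orb → ℂ) (b : ℕ → Orb → ℂ)
    (w : ℕ → Orb → ℂ) (hw : ∀ N x, w N x = a x * b N x)
    (size_nonneg : ∀ x, 0 ≤ size x)
    (b_support : ∀ N x, b N x ≠ 0 → arith N x)
    (a_bound : ∃ C c d : ℝ, 0 < c ∧
      ∀ x, ‖a x‖ ≤ C * (1 + size x) ^ d * Real.exp (-c * size x))
    (ρ : ℕ → ℝ) (hρ : Tendsto ρ atTop atTop)
    (size_of_arith : ∀ N x, arith N x → x ≠ x0 → ρ N ≤ size x)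
    (count_bound : ∃ C d : ℝ, ∀ N (R : ℝ), 0 ≤ R →
      ∃ s : Finset Orb, (∀ x, arith N x → size x ≤ R → x ∈ s) ∧ (s.card : ℝ) ≤ C * (1 + R) ^ d)
    (b_bound : ∃ B d : ℝ, ∀ N x, arith N x → ‖b N x‖ ≤ B * (1 + size x) ^ d * ‖b N x0‖)
    (a_x0 : a x0 ≠ 0) :
    ∃ N₁ : ℕ, ∀ N ≥ N₁,
      (∑' x, ‖(if x = x0 then 0 else w N x)‖) ≤ (1 / 2 : ℝ) * ‖w N x0‖ := by
  classical
  obtain ⟨C, c, d, hc, ha⟩ := a_bound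
  obtain ⟨C', d'', hcount⟩ := count_bound
  obtain ⟨B, d', hb⟩ := b_bound
  -- the constants of the comparison sequence
  set A : ℝ := |C| * |B| with hA
  set C₁ : ℝ := |C'| with hC₁
  set D : ℝ := max d 0 + max d' 0 with hD
  set E : ℝ := max d'' 0 + D with hE
  have hA0 : 0 ≤ A := by positivity
  have hC₁0 : 0 ≤ C₁ := abs_nonneg _
  have hD0 : 0 ≤ D := by positivity
  -- the majorant of the bracket and the count of a bracket
  set m : ℕ → ℝ := fun k => A * ((2 + (k : ℝ)) ^ D * Real.exp (-c * k)) with hm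
  set cnt : ℕ → ℝ := fun k => C₁ * (2 + (k : ℝ)) ^ (max d'' 0) with hcnt
  have hm0 : ∀ k, 0 ≤ m k := fun k => by
    simp only [hm]
    have : 0 ≤ (2 + (k : ℝ)) ^ D := Real.rpow_nonneg (by positivity) _
    positivity
  have hcnt0 : ∀ k, 0 ≤ cnt k := fun k => by
    simp only [hcnt]
    have : 0 ≤ (2 + (k : ℝ)) ^ (max d'' 0) := Real.rpow_nonneg (by positivity) _
    positivity
  -- the comparison sequence `cnt k * m k` and its tails
  have hcm : ∀ k, cnt k * m k = A * C₁ * ((2 + (k : ℝ)) ^ E * Real.exp (-c * k)) := by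
    intro k
    have h2k : (0 : ℝ) < 2 + (k : ℝ) := by positivity
    simp only [hm, hcnt, hE, hD, Real.rpow_add h2k]
    ring
  have hsum : Summable fun k => cnt k * m k := by
    simp only [hcm]
    exact (summable_polyExp E c hc).mul_left _
  have htail : Tendsto (fun K => ∑' j, cnt (j + K) * m (j + K)) atTop (𝓝 0) :=
    tendsto_sum_nat_add fun k => cnt k * m k
  have hε : 0 < (1 / 2 : ℝ) * ‖a x0‖ := by
    have : 0 < ‖a x0‖ := norm_pos_iff.2 a_x0
    positivity
  obtain ⟨K, hK⟩ : ∃ K : ℕ, ∀ K' ≥ K, ∑' j, cnt (j + K') * m (j + K') < (1 / 2 : ℝ) * ‖a x0‖ :=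
    eventually_atTop.1 ((tendsto_order.1 htail).2 _ hε)
  obtain ⟨N₁, hN₁⟩ : ∃ N₁ : ℕ, ∀ N ≥ N₁, (K : ℝ) ≤ ρ N :=
    eventually_atTop.1 (tendsto_atTop.1 hρ (K : ℝ))
  refine ⟨N₁, fun N hN => ?_⟩
  -- the majorant of the bracket on an orbit carrying weight
  have hmaj : ∀ x, arith N x → ‖a x‖ * ‖b N x‖ ≤ m ⌊size x⌋₊ * ‖b N x0‖ := by
    intro x hx
    have h1x : (1 : ℝ) ≤ 1 + size x := by linarith [size_nonneg x]
    have h0x : (0 : ℝ) < 1 + size x := by linarith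
    have hax : ‖a x‖ ≤ |C| * (1 + size x) ^ (max d 0) * Real.exp (-c * size x) := by
      calc ‖a x‖ ≤ C * (1 + size x) ^ d * Real.exp (-c * size x) := ha x
        _ ≤ |C| * (1 + size x) ^ (max d 0) * Real.exp (-c * size x) := by
          gcongr
          · exact le_abs_self C
          · exact le_max_left _ _
    have hbx : ‖b N x‖ ≤ |B| * (1 + size x) ^ (max d' 0) * ‖b N x0‖ := by
      calc ‖b N x‖ ≤ B * (1 + size x) ^ d' * ‖b N x0‖ := hb N x hx
        _ ≤ |B| * (1 + size x) ^ (max d' 0) * ‖b N x0‖ := by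
          gcongr
          · exact le_abs_self B
          · exact le_max_left _ _
    have hk1 : size x < (⌊size x⌋₊ : ℝ) + 1 := Nat.lt_floor_add_one _
    have hk2 : (⌊size x⌋₊ : ℝ) ≤ size x := Nat.floor_le (size_nonneg x)
    have hpow : (1 + size x) ^ D ≤ (2 + (⌊size x⌋₊ : ℝ)) ^ D :=
      Real.rpow_le_rpow h0x.le (by linarith) hD0
    have hexp : Real.exp (-c * size x) ≤ Real.exp (-c * (⌊size x⌋₊ : ℝ)) :=
      Real.exp_le_exp.2 (by nlinarith)
    calc ‖a x‖ * ‖b N x‖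
        ≤ (|C| * (1 + size x) ^ (max d 0) * Real.exp (-c * size x)) *
            (|B| * (1 + size x) ^ (max d' 0) * ‖b N x0‖) :=
          mul_le_mul hax hbx (norm_nonneg _) (by positivity)
      _ = A * ((1 + size x) ^ D * Real.exp (-c * size x)) * ‖b N x0‖ := by
          rw [hD, Real.rpow_add h0x, hA]; ring
      _ ≤ A * ((2 + (⌊size x⌋₊ : ℝ)) ^ D * Real.exp (-c * (⌊size x⌋₊ : ℝ))) * ‖b N x0‖ := by
          gcongr
      _ = m ⌊size x⌋₊ * ‖b N x0‖ := rfl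
  -- the count of a bracket
  have hcntk : ∀ k : ℕ, ∃ t : Finset Orb,
      (∀ x, arith N x → ⌊size x⌋₊ = k → x ∈ t) ∧ (t.card : ℝ) ≤ cnt k := by
    intro k
    obtain ⟨t, htmem, htcard⟩ := hcount N ((k : ℝ) + 1) (by positivity)
    refine ⟨t, fun x hx hk => htmem x hx ?_, ?_⟩
    · have := Nat.lt_floor_add_one (size x)
      rw [hk] at this
      exact this.le
    · have h2k : (1 : ℝ) ≤ 2 + (k : ℝ) := by linarith [(Nat.cast_nonneg k : (0 : ℝ) ≤ k)]
      calc (t.card : ℝ) ≤ C' * (1 + ((k : ℝ) + 1)) ^ d'' := htcard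
        _ = C' * (2 + (k : ℝ)) ^ d'' := by ring_nf
        _ ≤ C₁ * (2 + (k : ℝ)) ^ (max d'' 0) := by
          gcongr
          · exact le_abs_self C'
          · exact le_max_left _ _
  -- the bracket threshold
  have hKx : ∀ x, arith N x → x ≠ x0 → K ≤ ⌊size x⌋₊ := by
    intro x hx hx0
    apply Nat.le_floor
    calc (K : ℝ) ≤ ρ N := hN₁ N hN
      _ ≤ size x := size_of_arith N x hx hx0
  calc (∑' x, ‖(if x = x0 then 0 else w N x)‖)
      ≤ ‖b N x0‖ * ∑' j, cnt (j + K) * m (j + K) :=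
        tail_le_shifted_tsum N x0 size arith a b w hw (b_support N) m cnt hm0 hcnt0 hmaj hcntk K hKx hsum
    _ ≤ ‖b N x0‖ * ((1 / 2 : ℝ) * ‖a x0‖) := by
        gcongr
        exact (hK K le_rfl).le
    _ = (1 / 2 : ℝ) * ‖w N x0‖ := by rw [hw, norm_mul]; ring

/-- **The tail bound, linear threshold** (the shape with `ρ N = c₂ N − size x0`, `c₂ > 0`): in the
Gaussian–polynomial shapes of the module docstring, for `N` large the orbits other than `x0` contribute at
most half of the `x0`-term. -/
theorem tail_le_half
    (x0 : Orb) (size : Orb → ℝ) (arith : ℕ → Orb → Prop) (a : Orb → ℂ) (b : ℕ → Orb → ℂ)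
    (w : ℕ → Orb → ℂ) (hw : ∀ N x, w N x = a x * b N x)
    (size_nonneg : ∀ x, 0 ≤ size x)
    (b_support : ∀ N x, b N x ≠ 0 → arith N x)
    (a_bound : ∃ C c d : ℝ, 0 < c ∧
      ∀ x, ‖a x‖ ≤ C * (1 + size x) ^ d * Real.exp (-c * size x))
    (size_of_arith : ∃ c : ℝ, 0 < c ∧
      ∀ N x, arith N x → x ≠ x0 → c * (N : ℝ) - size x0 ≤ size x)
    (count_bound : ∃ C d : ℝ, ∀ N (R : ℝ), 0 ≤ R →
      ∃ s : Finset Orb, (∀ x, arith N x → size x ≤ R → x ∈ s) ∧ (s.card : ℝ) ≤ C * (1 + R) ^ d)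
    (b_bound : ∃ B d : ℝ, ∀ N x, arith N x → ‖b N x‖ ≤ B * (1 + size x) ^ d * ‖b N x0‖)
    (a_x0 : a x0 ≠ 0) :
    ∃ N₁ : ℕ, ∀ N ≥ N₁,
      (∑' x, ‖(if x = x0 then 0 else w N x)‖) ≤ (1 / 2 : ℝ) * ‖w N x0‖ := by
  obtain ⟨c₂, hc₂, hsize⟩ := size_of_arith
  have hρ : Tendsto (fun N : ℕ => c₂ * (N : ℝ) - size x0) atTop atTop := by
    have h1 : Tendsto (fun N : ℕ => c₂ * (N : ℝ)) atTop atTop :=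
      Tendsto.const_mul_atTop hc₂ tendsto_natCast_atTop_atTop
    exact tendsto_atTop_add_const_right _ _ h1
  exact tail_le_half_of_tendsto x0 size arith a b w hw size_nonneg b_support a_bound
    (fun N : ℕ => c₂ * (N : ℝ) - size x0) hρ hsize count_bound b_bound a_x0

end Main

end Summit.Ventures.HodgeRepro2.T7SupportDominantTermTail
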